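import Summits.QuantumFields.BalabanUV.Beta.FP.TowerFFamilyParities

/-!
# `BalabanUV.Beta.FP.TowerFFamilyParitiesW` — road «FP», binder row D1, ROUTE T, the (H5-F) option (3a) (road FINDING FP-70 ∕ A-4, journal [D1P3-G62-A4]; an2 g85 W-3 (a), W-5 (3)):
# **THE END's F-FAMILY PARITY LETTERS `hVFm hVFt` FOR ANY STEP WEIGHT FAMILY** — road g58 `TowerFFamilyParities` §2–§3 with the straight step column
# `wStep Lc (n+1)` replaced by a weight family `w n : EKer 4` (generator: `wStep Lc (n + 1) ↦ w n` ×9, names `… ↦ …_w`; §1's fibre-block letters `dressV_apply_inr_inr_VN ∕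
# dressV_inl_inr_transpose_VN` were ALREADY weight-generic and are imported BY NAME)

WHY (journal an2 g85 W-3 (a) ∕ W-5 (3): under (3a) the END dresses its F-family by the renormalised true weight `w n := fun c μ p => (α n)⁻¹ * wF Lc Q ℓ sn n c μ p` (an2 PART 96∕97);
road A-4 l.69214: of the four F-side letter files only `TowerFWindingRow` USES a property of `wStep` (its decay), the parities are structural).  v10's END binders `hVFm` (the periodised
first-order F-family vanishes on two multiplier indices) and `hVFt` (a field index against a multiplier index reads the same both ways) are discharged at the record by g58's
`hVFm_rec ∕ hVFt_rec` — AT `wStep`.  THIS FILE repeats the two statements and proofs token for token at a generic `w`, so that the (3a) skeleton's `hVFm ∕ hVFt` are by name at the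
lambda weight as well (no property of `w` is used: the parities come from `VN`'s fibre blocks, `VN_inr_inr ∕ VN_inl_inr_transpose`).

WHAT ([folklore] BY NAME; no `def`, no `def … : Prop`, nothing cited, 0 sorry): §1 `FRec_inr_inr_w`, `FRec_inl_inr_eq_transpose_w`; §2 **`hVFm_rec_w`**, **`hVFt_rec_w`** — v10's binder texts
under σ = {`(𝒱F (n+1))` ↦ `scaleK σ′ σ′ (Lc⁴ • dressV (Lc^(n+1)) Lc (w n) (VN ctr Pn n))`}.
WHAT THIS IS NOT: not the weight (PART 96); nothing of Bałaban's asserted, valued or discharged; 0 estimates; 0∕4 row-D1 binders (hW, hR, D1Tel, D1Rep); NOT (C1), NOT (T-ID), NOT D1,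
NEVER «G-an2-4 closed», NOT BetaPertH, NOT continuum, NOT Clay.

HONEST DEPENDENCY (page 1, mandatory): continuum YM on T⁴ ⇐ BetaPertH ∧ nine spine estimates (0/9 proved); BetaPertH ⇐ (D1) ∧ (D4) ∧ CAP+tail;
G-an2-4 gates asym, D1 and NE2/3/4.  HONEST FRAMING (cell contract, verbatim): «discharging `BetaPertH` makes Bałaban's UV stability UNCONDITIONAL —
a real constructive-QFT result; it is NOT the continuum limit and NOT the Clay problem.»  ABSOLUTE RULE (cell charter, verbatim): «No internally-minted
statement may enter as a cited fact. Every hypothesis is either kernel-proved in this package or a verbatim quotation of a PUBLISHED theorem with page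
reference. The manuscript(s) under audit are NOT citable for their own disputed steps — they are the thing under adjudication; programme-internal
(2001/route/tribunal) claims are never citable.»  Road «FP» OWNER, b2b-balaban-beta-d1-p3 gen 62, 2026-08-30.  No existing file touched.
-/

noncomputable section

open scoped BigOperators

namespace Summit.QuantumFields.BalabanUV.Beta.FP.TowerFFamilyParitiesW

open Finset
open Literature.MathematicalPhysics.QuantumFieldTheory
open Literature.MathematicalPhysics.QuantumFieldTheory.Balaban1983to89
open Literature.MathematicalPhysics.QuantumFieldTheory.Balaban1983to89.Beta
open B6Lemma24Torus (pbox)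
open ExpKernelCalculus (Site MKer)
open DressedMomentNormalisation (EKer)
open HessKerRate (scaleK scaleK_apply)
open HessianTelescopingKKT (wStep)
open OneStepResolventKernel (Fib)
open OneStepKernelFamily (vertexOfK)
open InterLevelTransport (cwsum_apply)
open Summit.QuantumFields.BalabanUV.Beta.CompositeOneShotJets (compV)
open Summit.QuantumFields.BalabanUV.Beta.CompositeOneShotJetData (Roots Pins AN VN)
open Summit.QuantumFields.BalabanUV.Beta.NVertexParities (VN_inr VN_inl_inr VN_inr_inr VbN_symm)
open Summit.QuantumFields.BalabanUV.Beta.FP.KernelPeriodisationFib (Idx perF perZ perF_apply perZ_apply)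
open Summit.QuantumFields.BalabanUV.Beta.FP.KernelPeriodisationFibLoc (dper dper_apply)
open Summit.QuantumFields.BalabanUV.Beta.FP.PeriodisedBorderTables (perZ_dper_symm)
open Summit.QuantumFields.BalabanUV.Beta.FP.KernelStepDressing (dressV dressV_apply)
open Summit.QuantumFields.BalabanUV.Beta.FP.TowerFFamilyParities (dressV_apply_inr_inr_VN dressV_inl_inr_transpose_VN)

variable {Lc : ℕ} [NeZero Lc] (R : Roots Lc) (P : Pins)

/-! ## §1 The END's first-order F-family `scaleK σ′ σ′ (Lc⁴ • dressV … (w n) …)` at a generic step weight family `w` -/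

section Family

variable (uF : ℕ → ℝ) (w : ℕ → EKer (3 + 1)) (n : ℕ)

/-- [folklore] the END's dressed first-order family has no multiplier–multiplier entries. -/
theorem FRec_inr_inr_w (μ : Fin (3 + 1)) (y x z : Site (3 + 1)) (m m' : Fin (3 + 1)) :
    scaleK (Sum.elim (fun _ : Fin (3 + 1) => (1 : ℝ)) (fun _ : Fin (3 + 1) => (uF n))) (Sum.elim (fun _ : Fin (3 + 1) => (1 : ℝ)) (fun _ : Fin (3 + 1) => (uF n)))
        ((Lc : ℝ) ^ 4 • dressV (Lc ^ (n + 1)) Lc (w n) (VN (Roots.ctr Lc) P n) μ y) x z (Sum.inr m) (Sum.inr m') = 0 := by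
  rw [scaleK_apply]
  simp only [Pi.smul_apply, smul_eq_mul, dressV_apply_inr_inr_VN, mul_zero, zero_mul]

/-- [folklore] the END's dressed first-order family reads `(inl α, inr m)` at `(x, z)` as `(inr m, inl α)` at `(z, x)` (equal units on both legs). -/
theorem FRec_inl_inr_eq_transpose_w (μ : Fin (3 + 1)) (y x z : Site (3 + 1)) (α m : Fin (3 + 1)) :
    scaleK (Sum.elim (fun _ : Fin (3 + 1) => (1 : ℝ)) (fun _ : Fin (3 + 1) => (uF n))) (Sum.elim (fun _ : Fin (3 + 1) => (1 : ℝ)) (fun _ : Fin (3 + 1) => (uF n)))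
        ((Lc : ℝ) ^ 4 • dressV (Lc ^ (n + 1)) Lc (w n) (VN (Roots.ctr Lc) P n) μ y) x z (Sum.inl α) (Sum.inr m)
      = scaleK (Sum.elim (fun _ : Fin (3 + 1) => (1 : ℝ)) (fun _ : Fin (3 + 1) => (uF n))) (Sum.elim (fun _ : Fin (3 + 1) => (1 : ℝ)) (fun _ : Fin (3 + 1) => (uF n)))
        ((Lc : ℝ) ^ 4 • dressV (Lc ^ (n + 1)) Lc (w n) (VN (Roots.ctr Lc) P n) μ y) z x (Sum.inr m) (Sum.inl α) := by
  rw [scaleK_apply, scaleK_apply]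
  simp only [Pi.smul_apply, smul_eq_mul, Sum.elim_inl, Sum.elim_inr, dressV_inl_inr_transpose_VN]
  ring

end Family

/-! ## §2 THE TWO LETTERS (generic weight), in v10's binder texts under σ = {`(𝒱F (n+1))` ↦ the dressed family}, for any index map landing in multiplier fibres -/

section Record

variable (Lc) (Pn : Pins) (uF : ℕ → ℝ) (w : ℕ → EKer (3 + 1))

/-- [folklore] **`hVFm` AT THE RECORD** — v10 `StepRecursionFeedNestedNamedI.d1Tel_JcComp_ctr_namedI`'s binder `hVFm` (L.246) with `(𝒱F (n + 1))` ↦ the σ′-scaled `Lc⁴ •` dressed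
N-vertex and the index map `(fF n) B` generic (`f`, landing in multiplier fibres — (H3)'s `hmF_rec` at the END): the periodised family VANISHES on two such indices. -/
theorem hVFm_rec_w {M : Fin (3 + 1) → ℕ} [∀ i, NeZero (M i)] {ι : Type*} (f : ι → Idx M (Fib 3)) (hf : ∀ a : ι, ∃ m : Fin (3 + 1), (f a).2 = Sum.inr m)
    (n : ℕ) (μ : Fin (3 + 1)) (y : Fin (3 + 1) → ℤ) (a a' : ι) :
    (perF M (dper M ((fun μ y => scaleK (Sum.elim (fun _ : Fin (3 + 1) => (1 : ℝ)) (fun _ : Fin (3 + 1) => (uF n))) (Sum.elim (fun _ : Fin (3 + 1) => (1 : ℝ)) (fun _ : Fin (3 + 1) => (uF n))) ((Lc : ℝ) ^ 4 • dressV (Lc ^ (n + 1)) Lc (w n) (VN (Roots.ctr Lc) Pn n) μ y)) μ y))) (f a) (f a') = 0 := by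
  obtain ⟨m, hm⟩ := hf a
  obtain ⟨m', hm'⟩ := hf a'
  have ha : f a = ((f a).1, Sum.inr m) := Prod.ext rfl hm
  have ha' : f a' = ((f a').1, Sum.inr m') := Prod.ext rfl hm'
  rw [ha, ha', perF_apply]
  simp only [perZ_apply, dper_apply, FRec_inr_inr_w, tsum_zero]

/-- [folklore] **`hVFt` AT THE RECORD** — v10's binder `hVFt` (L.247) under the same σ: a field index against an index in a multiplier fibre reads the same both ways
(fibre-entrywise the `(inl α, inr m)` entries are the transposed `(inr m, inl α)` ones, §2, and `perZ ∘ dper` transports a pointwise transpose symmetry — road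
`PeriodisedBorderTables.perZ_dper_symm`'s re-indexing, here for the two blocks that matter). -/
theorem hVFt_rec_w {M : Fin (3 + 1) → ℕ} [∀ i, NeZero (M i)] {ι : Type*} (f : ι → Idx M (Fib 3)) (hf : ∀ a : ι, ∃ m : Fin (3 + 1), (f a).2 = Sum.inr m)
    (n : ℕ) (μ : Fin (3 + 1)) (y : Fin (3 + 1) → ℤ) (b : ↥(pbox M) × Fin (3 + 1)) (a : ι) :
    (perF M (dper M ((fun μ y => scaleK (Sum.elim (fun _ : Fin (3 + 1) => (1 : ℝ)) (fun _ : Fin (3 + 1) => (uF n))) (Sum.elim (fun _ : Fin (3 + 1) => (1 : ℝ)) (fun _ : Fin (3 + 1) => (uF n))) ((Lc : ℝ) ^ 4 • dressV (Lc ^ (n + 1)) Lc (w n) (VN (Roots.ctr Lc) Pn n) μ y)) μ y))) (b.1, Sum.inl b.2) (f a)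
      = (perF M (dper M ((fun μ y => scaleK (Sum.elim (fun _ : Fin (3 + 1) => (1 : ℝ)) (fun _ : Fin (3 + 1) => (uF n))) (Sum.elim (fun _ : Fin (3 + 1) => (1 : ℝ)) (fun _ : Fin (3 + 1) => (uF n))) ((Lc : ℝ) ^ 4 • dressV (Lc ^ (n + 1)) Lc (w n) (VN (Roots.ctr Lc) Pn n) μ y)) μ y))) (f a) (b.1, Sum.inl b.2) := by
  obtain ⟨m, hm⟩ := hf a
  have ha : f a = ((f a).1, Sum.inr m) := Prod.ext rfl hm
  have hsym : ∀ (x z : Site (3 + 1)) (α' m' : Fin (3 + 1)),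
      scaleK (Sum.elim (fun _ : Fin (3 + 1) => (1 : ℝ)) (fun _ : Fin (3 + 1) => (uF n))) (Sum.elim (fun _ : Fin (3 + 1) => (1 : ℝ)) (fun _ : Fin (3 + 1) => (uF n)))
          ((Lc : ℝ) ^ 4 • dressV (Lc ^ (n + 1)) Lc (w n) (VN (Roots.ctr Lc) Pn n) μ y) x z (Sum.inl α') (Sum.inr m')
        = scaleK (Sum.elim (fun _ : Fin (3 + 1) => (1 : ℝ)) (fun _ : Fin (3 + 1) => (uF n))) (Sum.elim (fun _ : Fin (3 + 1) => (1 : ℝ)) (fun _ : Fin (3 + 1) => (uF n)))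
          ((Lc : ℝ) ^ 4 • dressV (Lc ^ (n + 1)) Lc (w n) (VN (Roots.ctr Lc) Pn n) μ y) z x (Sum.inr m') (Sum.inl α') :=
    fun x z α' m' => FRec_inl_inr_eq_transpose_w Pn uF w n μ y x z α' m'
  rw [ha, perF_apply, perF_apply]
  beta_reduce
  generalize scaleK (Sum.elim (fun _ : Fin (3 + 1) => (1 : ℝ)) (fun _ : Fin (3 + 1) => (uF n))) (Sum.elim (fun _ : Fin (3 + 1) => (1 : ℝ)) (fun _ : Fin (3 + 1) => (uF n)))
      ((Lc : ℝ) ^ 4 • dressV (Lc ^ (n + 1)) Lc (w n) (VN (Roots.ctr Lc) Pn n) μ y) = K at hsym ⊢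
  -- the symmetrised kernel: on the two blocks that matter it IS `K` (up to the transpose), and it is transpose-symmetric everywhere
  let S : MKer (3 + 1) (Fib 3) := fun x z a' b' =>
    match a', b' with
    | Sum.inl α', Sum.inr m₁ => K x z (Sum.inl α') (Sum.inr m₁)
    | Sum.inr m₁, Sum.inl α' => K z x (Sum.inl α') (Sum.inr m₁)
    | _, _ => 0
  have hS : ∀ (x z : Site (3 + 1)) (a' b' : Fib 3), S x z a' b' = S z x b' a' := by
    intro x z a' b'
    rcases a' with α' | m₁ <;> rcases b' with α'' | m₂ <;> rfl
  have e1 : perZ M (dper M K) ((b.1 : ↥(pbox M)) : Site (3 + 1)) (((f a).1 : ↥(pbox M)) : Site (3 + 1)) (Sum.inl b.2) (Sum.inr m)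
      = perZ M (dper M S) ((b.1 : ↥(pbox M)) : Site (3 + 1)) (((f a).1 : ↥(pbox M)) : Site (3 + 1)) (Sum.inl b.2) (Sum.inr m) := by
    simp only [perZ_apply, dper_apply]; rfl
  have e2 : perZ M (dper M K) (((f a).1 : ↥(pbox M)) : Site (3 + 1)) ((b.1 : ↥(pbox M)) : Site (3 + 1)) (Sum.inr m) (Sum.inl b.2)
      = perZ M (dper M S) (((f a).1 : ↥(pbox M)) : Site (3 + 1)) ((b.1 : ↥(pbox M)) : Site (3 + 1)) (Sum.inr m) (Sum.inl b.2) := by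
    simp only [perZ_apply, dper_apply, ← hsym]; rfl
  rw [e1, e2]
  exact perZ_dper_symm M hS _ _ _ _

end Record

end Summit.QuantumFields.BalabanUV.Beta.FP.TowerFFamilyParitiesW

end
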